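import Summits.Ventures.FusionMHD.Bench.SolovevPCFIterMercierMidThreshold
import Summits.Ventures.FusionMHD.Bench.SolovevPCFIterResistiveMidData
import Summits.Ventures.FusionMHD.Bench.SolovevPCFResistiveClosedForm
import Summits.Ventures.FusionMHD.Models.SolovevPCFResistiveIndex
import HarnessLib

/-!
# F1.DR — the resistive-interchange index `D_R` of the INTERIOR flux surface `ρ/ρ_e = 1/2` (Lee–Cerfon label `r = a/2 = ε/(2R_a)`)
# of the ITER-like PCF Solov'ev equilibrium: atoms, `⟨B²⟩`, and the identity `resistiveIndex = DRAtoms.DR` of the shared closed form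
(venture LADDER-GRIDFUSION, rung F1 sub-rung F1.DR, «F1.DR-PROFILE» extension of the edge rows #63/#64 to the interior surfaces whose
Mercier-profile inputs are of record (#20 «F1.MERCIER-MID-ITER», sos-6 p493730 … p497831); cell `gridfusion`, seat `gridfusion-model-7` (g0),
2026-08-27.  Inputs BY NAME: sos-6's `…MercierMid{Data1,2,3,Subst,Integrals,Threshold}` (atomic integrals `K1m…K8m`, dictionary `lcU_theta`/
`lcGradSq_theta`/`lcAvgWeight_mid`, brackets `A4m/A6m/A7m/phihatm/M2m/M0m`, `lcMidData`, `mercierF_lcMidData`); model-5's `IterLike.avgBsq_eq` /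
`resistiveIndex_eq_mercierD` (p492374); this seat's `K9m` certificate (`…ResistiveMidData`) and closed-form algebra (`…ResistiveClosedForm`).)

## The statement (three columns, never merged)
CERTIFIED (kernel, this file), MID-RADIUS surface of the ITER-like instance, free constant `g = F > 0`:
* `integral_gradSq_w_div_u_mid`: `∫₀^{2π} |∇Ψ|²·w/u dt = (4αρ²κ₀/c)·K9m`; `A9m = ⟨B_p²⟩ = 4αρ²K9m/K1m ∈ [0.0095018424071, 0.0095018424072]`;
  `avgBsq_mid`: `⟨B²⟩ = g²·A4m + A9m`;
* field identities of model-5's record `lcMidData g`: `Φ″ = g·phihatm·V′` (`Phi''_mid`), `⟨B²/G⟩ = g²A7m + A4m` (`gB2_mid`),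
  `⟨σB²/G⟩ = g·A6m` (`gsB2_mid`);
* **`resistiveIndex_mid_eq`: `IterLike.resistiveIndex g (ε/(2R_a)) = midAtoms.DR g`** with `midAtoms = ⟨A4m, A6m, A7m, A9m, π·phihatm, M2m, M0m⟩`,
  i.e. `D_R(g) = −(M2m − M0m/g²)/(4π²phihatm²) + (H − 1/2)²`, `H = ((g²A7m + A4m)/(g²A4m + A9m) − A6m)/(2π·phihatm)`;
* the two structural sign conditions `A4m² < A7m·A9m`, `X < 0` and hence **`D_R` strictly decreasing in `g` on `(0, ∞)`** on this surface
  (`resistiveIndex_mid_strictAntiOn`); brackets `piPhihatm_bounds`, `Sm_bounds` for the threshold file.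
LABEL «RESISTIVE-INTERCHANGE INDEX SIGN (criterion as printed, Zheng (3.42) / GGJ 1975) — not a tearing / resistive-wall statement».
MODELLED: ANALYTIC PCF Solov'ev equilibrium (ideal MHD, `μ₀p′ = −1`, `FF′ = 0`, fixed boundary; «ITER-like» = printed shape triple of
[cite: PatakiCerfonFreidberg2013, §6.1], not ITER); GGJ resistive-layer index evaluated on ideal-equilibrium inputs; `F` free; nothing here
says any plasma or device is stable.  VALIDATED (box B candidates, not used): model-5 `bench/F1DR-validated-lineageB.json` d2ab886dc86d0018
surface `rho_over_rhoe = 1/2`: `⟨B_p²⟩ = 0.0095018424`, `∫G·w/u = 0.133232034789`, `D_R(3/5) = −0.79754`, `D_R(1) = −3.59913`; model-7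
`cert/model-7/dr_check.py`.  No `decide` here (the enclosures are the imported Data files').
-/

noncomputable section

open Real MeasureTheory Set intervalIntegral
open Literature.Analysis.ValidatedNumerics Literature.Analysis.ValidatedNumerics.PolyMP
open Literature.Analysis.ValidatedNumerics.ExpPoly (Poly)
open Literature.MathematicalPhysics.MHD Literature.MathematicalPhysics.MHD.Solovev
open Literature.MathematicalPhysics.MHD.Mercier.FluxForm
open Summit.Ventures.FusionMHD.Models.SolovevPCF
open Summit.Ventures.FusionMHD.Bench.ResistiveClosedForm

namespace Summit.Ventures.FusionMHD.Bench.SolovevPCFIter.MercierMid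

open Summit.Ventures.FusionMHD.Bench.SolovevPCFIter.MercierEdge (theta integral_zero_two_pi_eq_theta eval_const_two
  sqrt_two_sub_pos uIcc01 kappa0_eq_div sqrt_q0Sq_eq lcAmp_eq csLC_edge d3alpha)

/-! ## §1 The one new atomic `t`-integral on the mid-radius loop -/

section atomic

variable {g : ℝ} (hg : 0 < g)
include hg

/-- Continuity of `G·w/u` on the mid-radius loop. [folklore] -/
theorem continuous_gradSq_w_div_u_mid : Continuous fun t =>
      lcGradSq IterLike.kappa0 g IterLike.Ra (IterLike.q0 g) (IterLike.ε / IterLike.Ra / 2) t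
        * lcAvgWeight IterLike.kappa0 g IterLike.Ra (IterLike.q0 g) (IterLike.ε / IterLike.Ra / 2) t
        / lcU IterLike.Ra (IterLike.ε / IterLike.Ra / 2) t :=
  (continuous_lcGradSq_mid.mul (continuous_w_mid hg)).div₀ continuous_lcU_mid fun t => (lcU_mid_pos t).ne'

/-- `T9` (mid-radius): **`∫₀^{2π} G·w/u dt = (κ₀·4αρ²/c)·K9m`**. [cite: Jardin2010, §5.3 eq. (5.30)] -/
theorem integral_gradSq_w_div_u_mid :
    ∫ t in (0 : ℝ)..(2 * π), lcGradSq IterLike.kappa0 g IterLike.Ra (IterLike.q0 g) (IterLike.ε / IterLike.Ra / 2) t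
        * lcAvgWeight IterLike.kappa0 g IterLike.Ra (IterLike.q0 g) (IterLike.ε / IterLike.Ra / 2) t
        / lcU IterLike.Ra (IterLike.ε / IterLike.Ra / 2) t
      = IterLike.kappa0 * c4m / (2257675225 / 6032287802 : ℝ) * K9m := by
  have hg' := hg.ne'
  rw [integral_zero_two_pi_eq_theta _ (continuous_gradSq_w_div_u_mid hg)
    (fun t => by simp only [lcAvgWeight_mid hg', lcU_two_pi_sub, lcGradSq_two_pi_sub hg'])]
  have key : ∀ w ∈ uIcc (0:ℝ) 1,
      (lcGradSq IterLike.kappa0 g IterLike.Ra (IterLike.q0 g) (IterLike.ε / IterLike.Ra / 2) (theta w)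
          * lcAvgWeight IterLike.kappa0 g IterLike.Ra (IterLike.q0 g) (IterLike.ε / IterLike.Ra / 2) (theta w)
          / lcU IterLike.Ra (IterLike.ε / IterLike.Ra / 2) (theta w)
        + lcGradSq IterLike.kappa0 g IterLike.Ra (IterLike.q0 g) (IterLike.ε / IterLike.Ra / 2) (π - theta w)
          * lcAvgWeight IterLike.kappa0 g IterLike.Ra (IterLike.q0 g) (IterLike.ε / IterLike.Ra / 2) (π - theta w)
          / lcU IterLike.Ra (IterLike.ε / IterLike.Ra / 2) (π - theta w))
        * (2 / Real.sqrt (2 - w ^ 2))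
      = IterLike.kappa0 * c4m / (2 * (2257675225 / 6032287802 : ℝ)) * (K9me.toFun w * Poly.eval [2] w) := by
    intro w hw
    rw [uIcc01] at hw
    rw [lcAvgWeight_mid hg', lcAvgWeight_mid hg', lcGradSq_theta hg' hw, lcGradSq_pi_sub_theta hg' hw,
      lcU_theta hw, lcU_pi_sub_theta hw, toFun_K9me, eval_const_two]
    have hP1 : PpMid w ≠ 0 := (PpMid_pos hw).ne'
    have hP2 : PmMid w ≠ 0 := (PmMid_pos hw).ne'
    have hU1 : UpMid w ≠ 0 := (UpMid_pos hw).ne'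
    have hU2 : UmMid w ≠ 0 := (UmMid_pos w).ne'
    have h3 : Real.sqrt (UpMid w) ≠ 0 := (Real.sqrt_pos.2 (UpMid_pos hw)).ne'
    have h4 : Real.sqrt (UmMid w) ≠ 0 := (Real.sqrt_pos.2 (UmMid_pos w)).ne'
    have h5 : Real.sqrt (2 - w ^ 2) ≠ 0 := (sqrt_two_sub_pos hw).ne'
    have hc4 : c4m ≠ 0 := c4m_pos.ne'
    field_simp
  rw [integral_congr key, intervalIntegral.integral_const_mul]
  unfold K9m
  ring

end atomic

/-! ## §2 `⟨B_p²⟩` and `⟨B²⟩` of the mid-radius surface -/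

/-- `A9m := ⟨B_p²⟩ = 4αρ²·K9m/K1m` of the mid-radius surface. [cite: Jardin2010, §5.3 eq. (5.30)] -/
def A9m : ℝ := c4m * K9m / K1m

/-- `A9m ∈ [0.0095018424071, 0.0095018424072]` (width 10⁻¹³). [folklore] -/
theorem A9m_bounds : (95018424071 / 10000000000000 : ℝ) ≤ A9m ∧ A9m ≤ (11877303009 / 1250000000000 : ℝ) := by
  obtain ⟨h1l, h1h⟩ := K1m_bounds; obtain ⟨h9l, h9h⟩ := K9m_bounds
  have hK1 := K1m_pos
  unfold A9m
  constructor
  · rw [le_div_iff₀ hK1]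
    calc (95018424071 / 10000000000000 : ℝ) * K1m
        ≤ (95018424071 / 10000000000000 : ℝ) * ((3677206299194968688965267/1208925819614629174706176 : ℚ) : ℝ) := by gcongr
      _ ≤ c4m * ((455844220310518847922513/604462909807314587353088 : ℚ) : ℝ) := by unfold c4m; push_cast; norm_num
      _ ≤ c4m * K9m := by unfold c4m; gcongr
  · rw [div_le_iff₀ hK1]
    calc c4m * K9m ≤ c4m * ((113961055077631104576499/151115727451828646838272 : ℚ) : ℝ) := by unfold c4m; gcongr
      _ ≤ (11877303009 / 1250000000000 : ℝ) * ((3677206299194938517308491/1208925819614629174706176 : ℚ) : ℝ) := by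
          unfold c4m; push_cast; norm_num
      _ ≤ (11877303009 / 1250000000000 : ℝ) * K1m := by gcongr

/-- `A9m > 0`, `A4m > 0`, `phihatm > 0`. [folklore] -/
theorem A9m_A4m_phihatm_pos : 0 < A9m ∧ 0 < A4m ∧ 0 < phihatm :=
  ⟨lt_of_lt_of_le (by norm_num) A9m_bounds.1, lt_of_lt_of_le (by norm_num) A4m_bounds.1,
    lt_of_lt_of_le (by norm_num) phihatm_bounds.1⟩

/-- **`⟨B²⟩` of the mid-radius surface: `⟨B²⟩ = g²·A4m + A9m`** (model-5's `avgBsq_eq` with `T1`, `T6b`, `T9` of the mid chain).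
[cite: Jardin2010, §5.3 eq. (5.30)] -/
theorem avgBsq_mid {g : ℝ} (hg : 0 < g) : IterLike.avgBsq g (IterLike.ε / IterLike.Ra / 2) = g ^ 2 * A4m + A9m := by
  rw [IterLike.avgBsq_eq hg mid_minorRadius.1 mid_minorRadius.2, integral_w_div_u_mid hg, integral_w_mid hg,
    integral_gradSq_w_div_u_mid hg]
  unfold A4m A9m
  have hk := IterLike.kappa0_pos
  have hK := K1m_pos
  have hc4 := c4m_pos
  field_simp

/-! ## §3 The record `lcMidData g` field by field (what the resistive index needs) -/

section fields

variable {g : ℝ} (hg : 0 < g)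
include hg

/-- `Φ″ = g·phihatm·V′` on the mid-radius record (`Φ″/V′ = −3q₀R_a²K3m/(2πκ₀rK1m)`, `arm = c·rR_a/2`). [cite: Jardin2010, §8.5 eq. (8.134)] -/
theorem Phi''_mid : (lcMidData g).Φ'' = g * phihatm * (lcMidData g).V' := by
  obtain ⟨hr, h2r⟩ := mid_minorRadius
  unfold lcMidData phihatm
  rw [lcGGJData_Φ'' IterLike.Ra_pos IterLike.kappa0_pos hg (IterLike.q0_pos hg) hr h2r,
    lcGGJData_V' IterLike.Ra_pos IterLike.kappa0_pos hg (IterLike.q0_pos hg) hr h2r,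
    integral_qKernelDr_mid, integral_w_mid hg, lcAmp_eq hg.ne', IterLike.q0_eq g hg.le, sqrt_q0Sq_eq, kappa0_eq_div]
  have hs : 0 < Real.sqrt d3alpha := Real.sqrt_pos.2 (by unfold MercierEdge.d3alpha; norm_num)
  have hR := IterLike.Ra_pos
  have hπ := Real.pi_pos
  have hK := K1m_pos
  unfold arm IterLike.ε
  field_simp
  ring

/-- `⟨B²/|∇Ψ|²⟩ = g²·A7m + A4m` on the mid-radius record. [cite: Jardin2010, §8.5 eq. (8.134)] -/
theorem gB2_mid : (lcMidData g).gB2 = g ^ 2 * A7m + A4m := by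
  obtain ⟨hr, h2r⟩ := mid_minorRadius
  unfold lcMidData A7m A4m
  rw [lcGGJData_gB2 IterLike.Ra_pos IterLike.kappa0_pos hg (IterLike.q0_pos hg) hr h2r, integral_w_mid hg]
  have hsplit : ∀ t, (g ^ 2 + lcGradSq IterLike.kappa0 g IterLike.Ra (IterLike.q0 g) (IterLike.ε / IterLike.Ra / 2) t)
        / (lcU IterLike.Ra (IterLike.ε / IterLike.Ra / 2) t
            * lcGradSq IterLike.kappa0 g IterLike.Ra (IterLike.q0 g) (IterLike.ε / IterLike.Ra / 2) t)
        * lcAvgWeight IterLike.kappa0 g IterLike.Ra (IterLike.q0 g) (IterLike.ε / IterLike.Ra / 2) t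
      = g ^ 2 * (lcAvgWeight IterLike.kappa0 g IterLike.Ra (IterLike.q0 g) (IterLike.ε / IterLike.Ra / 2) t
          / (lcU IterLike.Ra (IterLike.ε / IterLike.Ra / 2) t
              * lcGradSq IterLike.kappa0 g IterLike.Ra (IterLike.q0 g) (IterLike.ε / IterLike.Ra / 2) t))
        + lcAvgWeight IterLike.kappa0 g IterLike.Ra (IterLike.q0 g) (IterLike.ε / IterLike.Ra / 2) t
          / lcU IterLike.Ra (IterLike.ε / IterLike.Ra / 2) t := by
    intro t
    have hu := (lcU_mid_pos t).ne'
    have hG := (lcGradSq_mid_pos hg t).ne'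
    set r₀ := IterLike.ε / IterLike.Ra / 2 with hr₀
    field_simp
  simp_rw [hsplit]
  rw [intervalIntegral.integral_add (((continuous_w_div_uG_mid hg).const_mul _).intervalIntegrable _ _)
    ((continuous_w_div_u_mid hg).intervalIntegrable _ _), intervalIntegral.integral_const_mul,
    integral_w_div_uG_mid hg, integral_w_div_u_mid hg]
  have hk := IterLike.kappa0_pos
  have hK := K1m_pos
  have hc4 := c4m_pos
  field_simp

/-- `⟨σB²/|∇Ψ|²⟩ = g·A6m` on the mid-radius record (`C_s = 1`). [cite: Jardin2010, §8.5 eq. (8.134)] -/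
theorem gsB2_mid : (lcMidData g).gσB2 = g * A6m := by
  obtain ⟨hr, h2r⟩ := mid_minorRadius
  unfold lcMidData A6m
  rw [lcGGJData_gσB2 IterLike.Ra_pos IterLike.kappa0_pos hg (IterLike.q0_pos hg) hr h2r, integral_w_mid hg,
    integral_w_div_G_mid hg, csLC_edge hg]
  have hk := IterLike.kappa0_pos
  have hK := K1m_pos
  have hc4 := c4m_pos
  field_simp

end fields

/-! ## §4 The atoms of the surface and `resistiveIndex = DR` -/

/-- The seven certified atoms of the mid-radius surface: `⟨A4m, A6m, A7m, A9m, π·phihatm, M2m, M0m⟩`. [cite: Zheng2015, §3.2 eq. (3.42)] -/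
def midAtoms : DRAtoms := ⟨A4m, A6m, A7m, A9m, π * phihatm, M2m, M0m⟩

/-- Positivity of the atoms used by the closed form: `A4m, A9m, π·phihatm > 0`. [folklore] -/
theorem midAtoms_pos : 0 < midAtoms.A4 ∧ 0 < midAtoms.A9 ∧ 0 < midAtoms.P := by
  obtain ⟨h9, h4, hph⟩ := A9m_A4m_phihatm_pos
  exact ⟨h4, h9, by show 0 < π * phihatm; positivity⟩

/-- `Φ″ ≠ 0` on the mid-radius record (positive shear). [cite: Jardin2010, §8.5 eq. (8.134)] -/
theorem ggjData_mid_Φ''_ne {g : ℝ} (hg : 0 < g) : (IterLike.ggjData g (IterLike.ε / IterLike.Ra / 2)).Φ'' ≠ 0 := by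
  show (lcMidData g).Φ'' ≠ 0
  rw [Phi''_mid hg]
  have hV : (lcMidData g).V' ≠ 0 :=
    lcGGJData_V'_ne IterLike.Ra_pos IterLike.kappa0_pos hg (IterLike.q0_pos hg) mid_minorRadius.1 mid_minorRadius.2 _ _
  have hph := A9m_A4m_phihatm_pos.2.2
  exact mul_ne_zero (mul_pos hg hph).ne' hV

/-- **model-5's `IterLike.resistiveIndex` OF THE MID-RADIUS SURFACE EQUALS THE SHARED CLOSED FORM `midAtoms.DR g`** (`g > 0`).
[cite: Zheng2015, §3.2 eq. (3.42)] -/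
theorem resistiveIndex_mid_eq {g : ℝ} (hg : 0 < g) : IterLike.resistiveIndex g (IterLike.ε / IterLike.Ra / 2) = midAtoms.DR g := by
  have hΦ := ggjData_mid_Φ''_ne hg
  rw [IterLike.resistiveIndex_eq_mercierD hg mid_minorRadius.1 mid_minorRadius.2 hΦ, avgBsq_mid hg]
  change (lcMidData g).mercierD - 1 / 4
      + ((lcMidData g).V' * (lcMidData g).gB2 / (lcMidData g).shear
          * ((lcMidData g).gσB2 / (lcMidData g).gB2 - g / (g ^ 2 * A4m + A9m)) - 1 / 2) ^ 2 = midAtoms.DR g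
  have hΨ2 : (lcMidData g).Ψ'' = 0 := rfl
  have hΨ1 : (lcMidData g).Ψ' = 2 * π := rfl
  have hV : (lcMidData g).V' ≠ 0 :=
    lcGGJData_V'_ne IterLike.Ra_pos IterLike.kappa0_pos hg (IterLike.q0_pos hg) mid_minorRadius.1 mid_minorRadius.2 _ _
  unfold SurfaceData.mercierD SurfaceData.shear
  rw [mercierF_lcMidData hg, Phi''_mid hg, hΨ1, hΨ2, gB2_mid hg, gsB2_mid hg]
  unfold midAtoms DRAtoms.DR DRAtoms.H DRAtoms.N DRAtoms.Dn
  obtain ⟨h9, h4, hph⟩ := A9m_A4m_phihatm_pos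
  have hA7 : 0 < A7m := lt_of_lt_of_le (by norm_num) A7m_bounds.1
  have hπ := Real.pi_pos
  have hD : g ^ 2 * A4m + A9m ≠ 0 := by positivity
  have hN : g ^ 2 * A7m + A4m ≠ 0 := by positivity
  have hg' := hg.ne'
  set V := (lcMidData g).V' with hVdef
  field_simp
  ring

/-! ## §5 The two structural sign conditions on this surface, the brackets, and monotonicity -/

/-- `π·phihatm ∈ [4.37483049647, 4.37483049649]`. [folklore] -/
theorem piPhihatm_bounds : (437483049647 / 100000000000 : ℝ) ≤ π * phihatm ∧ π * phihatm ≤ (437483049649 / 100000000000 : ℝ) := by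
  obtain ⟨hPl, hPh⟩ := phihatm_bounds
  have hpi1 := Real.pi_gt_d20
  have hpi2 := Real.pi_lt_d20
  constructor
  · calc (437483049647 / 100000000000 : ℝ) ≤ 3.14159265358979323846 * (1392551797407 / 1000000000000 : ℝ) := by norm_num
      _ ≤ π * phihatm := mul_le_mul hpi1.le hPl (by norm_num) Real.pi_pos.le
  · calc π * phihatm ≤ 3.14159265358979323847 * (43517243669 / 31250000000 : ℝ) :=
          mul_le_mul hpi2.le hPh (by linarith) (by norm_num)
      _ ≤ (437483049649 / 100000000000 : ℝ) := by norm_num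

/-- `S = A6m + π·phihatm` bracket. [folklore] -/
theorem Sm_bounds : (15363600308949 / 125000000000 : ℝ) ≤ midAtoms.A6 + midAtoms.P
    ∧ midAtoms.A6 + midAtoms.P ≤ (4916352098871 / 40000000000 : ℝ) := by
  obtain ⟨h6l, h6h⟩ := A6m_bounds; obtain ⟨hPl, hPh⟩ := piPhihatm_bounds
  show _ ≤ A6m + π * phihatm ∧ A6m + π * phihatm ≤ _
  constructor <;> linarith

/-- `A4m² < A7m·A9m` on the mid-radius surface. [folklore] -/
theorem A4m_sq_lt : midAtoms.A4 ^ 2 < midAtoms.A7 * midAtoms.A9 := by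
  show A4m ^ 2 < A7m * A9m
  obtain ⟨hA4l, hA4h⟩ := A4m_bounds; obtain ⟨hA7l, hA7h⟩ := A7m_bounds; obtain ⟨hA9l, hA9h⟩ := A9m_bounds
  have h1 : (59269319965459 / 500000000000 : ℝ) * (95018424071 / 10000000000000 : ℝ) ≤ A7m * A9m :=
    mul_le_mul hA7l hA9l (by norm_num) (le_trans (by norm_num) hA7l)
  have h2 : A4m ^ 2 ≤ (24229823087 / 25000000000 : ℝ) ^ 2 := pow_le_pow_left₀ (le_trans (by norm_num) hA4l) hA4h 2
  have h3 : (24229823087 / 25000000000 : ℝ) ^ 2 < (59269319965459 / 500000000000 : ℝ) * (95018424071 / 10000000000000 : ℝ) := by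
    norm_num
  linarith

/-- `X(g) < 0` for every `g` on the mid-radius surface (`A7m < S·A4m`, `A4m < S·A9m`). [folklore] -/
theorem Xm_neg (g : ℝ) : midAtoms.X g < 0 := by
  obtain ⟨hA4l, hA4h⟩ := A4m_bounds; obtain ⟨hA7l, hA7h⟩ := A7m_bounds; obtain ⟨hA9l, hA9h⟩ := A9m_bounds
  obtain ⟨hSl, hSh⟩ := Sm_bounds
  have h1 : (15363600308949 / 125000000000 : ℝ) * (969192923479 / 1000000000000 : ℝ)
      ≤ (midAtoms.A6 + midAtoms.P) * A4m := mul_le_mul hSl hA4l (by norm_num) (le_trans (by norm_num) hSl)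
  have h2 : (15363600308949 / 125000000000 : ℝ) * (95018424071 / 10000000000000 : ℝ)
      ≤ (midAtoms.A6 + midAtoms.P) * A9m := mul_le_mul hSl hA9l (by norm_num) (le_trans (by norm_num) hSl)
  refine DRAtoms.X_neg_of ?_ ?_ g
  · show A7m < (midAtoms.A6 + midAtoms.P) * A4m; linarith
  · show A4m < (midAtoms.A6 + midAtoms.P) * A9m; linarith

/-- **`D_R` of the mid-radius surface is STRICTLY DECREASING in `g` on `(0, ∞)`** (closed form). [cite: Zheng2015, §3.2 eq. (3.42)] -/
theorem DRm_strictAntiOn : StrictAntiOn midAtoms.DR (Set.Ioi 0) := by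
  obtain ⟨h4, h9, hP⟩ := midAtoms_pos
  have hM0 : 0 < midAtoms.M0 := by show 0 < M0m; exact lt_of_lt_of_le (by norm_num) M0m_bounds.1
  exact DRAtoms.DR_strictAntiOn_of h4 h9 hP hM0 A4m_sq_lt Xm_neg

/-- **model-5's `resistiveIndex` of the mid-radius surface is strictly decreasing in the free constant on `(0, ∞)`.**
[cite: Zheng2015, §3.2 eq. (3.42)] -/
theorem resistiveIndex_mid_strictAntiOn :
    StrictAntiOn (fun g => IterLike.resistiveIndex g (IterLike.ε / IterLike.Ra / 2)) (Set.Ioi 0) := by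
  intro g₁ h₁ g₂ h₂ hlt
  show IterLike.resistiveIndex g₂ (IterLike.ε / IterLike.Ra / 2) < IterLike.resistiveIndex g₁ (IterLike.ε / IterLike.Ra / 2)
  rw [resistiveIndex_mid_eq (show 0 < g₁ from h₁), resistiveIndex_mid_eq (show 0 < g₂ from h₂)]
  exact DRm_strictAntiOn h₁ h₂ hlt

end Summit.Ventures.FusionMHD.Bench.SolovevPCFIter.MercierMid

end
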